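import Literature.Probability.RandomPlanarGeometry.SAWPulledLargeForceExpansionZdFirstOrder
import HarnessLib

/-!
# Irreducible bridges of span one on `ℤ^{d+1}` are the self-avoiding walks of `ℤ^d`: `N_{c,c+1} = c_c(ℤ^d)`

Topic `Literature/Probability/RandomPlanarGeometry` (uses `SAWPulledLargeForceExpansionZd.lean`: the cost grading `costZd`, `costCoeffZd d c n = N_{c,n}`
of the pulled-walk expansion on `ℤ^{d+1}`; `SAWCount.lean`: `saws d n`, `card_saws : #saws d n = count d n = c_n(ℤ^d)`).

An irreducible bridge of `ℤ^{d+1}` of length `c + 1` and cost `c` has span one: after its first step `+e₀` it stays in the hyperplane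
`{x₀ = 1}` and performs a `c`-step self-avoiding walk there; conversely every such lift is an irreducible bridge (no renewal time, since the
height never exceeds `1` again). Hence the top-length coefficient of every cost polynomial of the large-force expansion is a self-avoiding-walk
count one dimension down: **`N_{c,c+1}(ℤ^{d+1}) = c_c(ℤ^d)`** — e.g. `N_{1,2} = 2d`, `N_{2,3} = 2d(2d−1)`, `N_{3,4} = 2d(2d−1)²`,
`N_{4,5} = c₄(ℤ^d)`, `N_{5,6} = c₅(ℤ^d)` (the closed forms of the sequels `…ZdFirstOrder` … `…ZdFifthOrder` thereby evaluate `c₄(ℤ^d)`,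
`c₅(ℤ^d)` in every dimension).

## Contents (all PROVED, standard axioms; no data)
`liftWalk` / `dropWalk` (the hyperplane lift `σ ↦ (0, (1,σ₀), (1,σ₁), …)` and its inverse), adjacency and injectivity transfer lemmas,
`liftWalk_mem_filter`, `dropWalk_mem_saws_and_eq`, ★ `filter_costZd_self_succ_eq_image`, ★★ **`costCoeffZd_self_succ :
costCoeffZd d c (c + 1) = count d c`**; corollaries `count_one_eq_two_mul` (`c₁(ℤ^d) = 2d`), `count_two_eq` (`c₂(ℤ^d) = 2d(2d−1)`) from the
cost-one / cost-two census of `SAWPulledLargeForceExpansionZdFirstOrder`. [cite: MadrasSlade1993, Definition 1.2.4] [cite: MadrasSlade1993, §4.2, eq. (4.2.20)–(4.2.22) (p. 94, 2013 reprint)]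

Provenance: lane «pcv-sawmu», a-p3 g16 (2026-08-24).
-/

noncomputable section

open Finset
open scoped BigOperators
open Literature.Probability.LatticeModels
open Literature.Probability.RandomPlanarGeometry.SAW

namespace Literature.Probability.RandomPlanarGeometry.SAW.Zd

/-! ### The hyperplane lift and its inverse -/

/-- The lift of a transverse walk `σ` to `ℤ^{d+1}`: `0 ↦ 0`, `i + 1 ↦ (1, σ i)`. [cite: MadrasSlade1993, Definition 1.2.4] -/
def liftWalk (d : ℕ) (σ : ℕ → Site d) : ℕ → Site (d + 1) := fun i =>
  if i = 0 then 0 else Fin.cons 1 (σ (i - 1))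

/-- The transverse part of a walk of `ℤ^{d+1}` after its first step: `i ↦ tail (ω (i+1))`. [cite: MadrasSlade1993, Definition 1.2.4] -/
def dropWalk (d : ℕ) (ω : ℕ → Site (d + 1)) : ℕ → Site d := fun i => Fin.tail (ω (i + 1))

/-- Value of the lift at `0`. [cite: MadrasSlade1993, Definition 1.2.4] -/
@[simp] theorem liftWalk_zero (d : ℕ) (σ : ℕ → Site d) : liftWalk d σ 0 = 0 := by simp [liftWalk]

/-- Value of the lift at `i + 1`. [cite: MadrasSlade1993, Definition 1.2.4] -/
@[simp] theorem liftWalk_succ (d : ℕ) (σ : ℕ → Site d) (i : ℕ) : liftWalk d σ (i + 1) = Fin.cons 1 (σ i) := by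
  simp [liftWalk]

/-- Heights of the lift: `0, 1, 1, …`. [cite: MadrasSlade1993, Definition 1.2.4] -/
theorem liftWalk_apply_zero (d : ℕ) (σ : ℕ → Site d) (i : ℕ) : liftWalk d σ i 0 = if i = 0 then 0 else 1 := by
  rcases i with _ | i
  · simp
  · rw [liftWalk_succ, if_neg (Nat.succ_ne_zero i)]
    exact Fin.cons_zero _ _

/-- A transverse unit vector of `ℤ^{d+1}` is the `cons 0` of a unit vector of `ℤ^d`. [cite: MadrasSlade1993, Definition 1.2.4] -/
theorem single_succ_eq_cons (d : ℕ) (j : Fin d) (a : ℤ) : (Pi.single j.succ a : Site (d + 1)) = Fin.cons 0 (Pi.single j a) := by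
  ext i
  refine Fin.cases ?_ (fun k => ?_) i
  · rw [Fin.cons_zero, Pi.single_eq_of_ne (Fin.succ_ne_zero j).symm]
  · rw [Fin.cons_succ]
    by_cases h : k = j
    · subst h; rw [Pi.single_eq_same, Pi.single_eq_same]
    · rw [Pi.single_eq_of_ne h, Pi.single_eq_of_ne (fun h' => h (Fin.succ_injective _ h'))]

/-- `cons a x + cons b y = cons (a + b) (x + y)`. [cite: MadrasSlade1993, Definition 1.2.4] -/
theorem cons_add_cons (d : ℕ) (a b : ℤ) (x y : Site d) : (Fin.cons a x : Site (d + 1)) + Fin.cons b y = Fin.cons (a + b) (x + y) := by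
  ext i
  refine Fin.cases ?_ (fun k => ?_) i
  · simp
  · simp

/-- Same-height lattice neighbours of `ℤ^{d+1}` project to neighbours of `ℤ^d`, and conversely. [cite: MadrasSlade1993, Definition 1.2.4] -/
theorem adj_cons_iff (d : ℕ) (a : ℤ) (x y : Site d) :
    (zdGraph (d + 1)).Adj (Fin.cons a x) (Fin.cons a y) ↔ (zdGraph d).Adj x y := by
  rw [zdGraph_adj_iff, zdGraph_adj_iff]
  constructor
  · rintro ⟨i, hi | hi⟩
    · have hi0 : i ≠ 0 := by
        rintro rfl
        have := congrFun hi 0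
        simp at this
      obtain ⟨j, rfl⟩ := Fin.exists_succ_eq.2 hi0
      refine ⟨j, Or.inl ?_⟩
      rw [single_succ_eq_cons, cons_add_cons, add_zero] at hi
      have := congrArg Fin.tail hi
      simpa using this
    · have hi0 : i ≠ 0 := by
        rintro rfl
        have := congrFun hi 0
        simp at this
      obtain ⟨j, rfl⟩ := Fin.exists_succ_eq.2 hi0
      refine ⟨j, Or.inr ?_⟩
      rw [single_succ_eq_cons, cons_add_cons, add_zero] at hi
      have := congrArg Fin.tail hi
      simpa using this
  · rintro ⟨j, hj | hj⟩
    · refine ⟨j.succ, Or.inl ?_⟩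
      rw [single_succ_eq_cons, cons_add_cons, add_zero, hj]
    · refine ⟨j.succ, Or.inr ?_⟩
      rw [single_succ_eq_cons, cons_add_cons, add_zero, hj]

/-- A site of height `1` of `ℤ^{d+1}` is the `cons 1` of its tail. [cite: MadrasSlade1993, Definition 1.2.4] -/
theorem eq_cons_tail_of_apply_zero {d : ℕ} {x : Site (d + 1)} (h : x 0 = 1) : x = Fin.cons 1 (Fin.tail x) := by
  rw [← h]; exact (Fin.cons_self_tail x).symm

/-! ### The lift of a self-avoiding walk of `ℤ^d` is an irreducible bridge of cost `c` and length `c + 1` -/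

/-- The lift of a `c`-step self-avoiding walk is a `(c+1)`-step self-avoiding walk. [cite: MadrasSlade1993, Definition 1.2.4] -/
theorem liftWalk_mem_saws (d : ℕ) {c : ℕ} {σ : ℕ → Site d} (hσ : σ ∈ saws d c) : liftWalk d σ ∈ saws (d + 1) (c + 1) := by
  obtain ⟨h0, hend, hadj, hinj⟩ := mem_saws.1 hσ
  refine mem_saws.2 ⟨liftWalk_zero d σ, fun i hi => ?_, fun i hi => ?_, ?_⟩
  · obtain ⟨i, rfl⟩ : ∃ j, i = j + 1 := ⟨i - 1, by omega⟩
    rw [liftWalk_succ, liftWalk_succ, hend i (by omega)]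
  · rcases i with _ | i
    · rw [liftWalk_zero, zero_add, liftWalk_succ, h0, zdGraph_adj_iff]
      refine ⟨0, Or.inl ?_⟩
      ext k
      refine Fin.cases ?_ (fun j => ?_) k
      · simp
      · simp
    · rw [liftWalk_succ, liftWalk_succ, adj_cons_iff]
      exact hadj i (by omega)
  · intro i hi j hj h
    simp only [Set.mem_setOf_eq] at hi hj
    have hh := congrFun h 0
    rw [liftWalk_apply_zero, liftWalk_apply_zero] at hh
    rcases i with _ | i <;> rcases j with _ | j
    · rfl
    · simp at hh
    · simp at hh
    · rw [liftWalk_succ, liftWalk_succ] at h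
      have h' : σ i = σ j := by simpa using congrArg Fin.tail h
      have := hinj (show i ∈ {k | k ≤ c} by simp only [Set.mem_setOf_eq]; omega)
        (show j ∈ {k | k ≤ c} by simp only [Set.mem_setOf_eq]; omega) h'
      rw [this]

/-- The lift is a bridge of span one, irreducible, of cost `c`. [cite: DuminilCopinHammond2013, §2.2] -/
theorem liftWalk_mem_filter (d : ℕ) {c : ℕ} {σ : ℕ → Site d} (hσ : σ ∈ saws d c) :
    liftWalk d σ ∈ (irreducibleBridges (d + 1) (c + 1)).filter fun ω => costZd d (c + 1) ω = c := by
  have hb : IsBridge (c + 1) (liftWalk d σ) := by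
    intro i h1 h2
    rw [liftWalk_apply_zero, liftWalk_apply_zero, liftWalk_apply_zero, if_pos rfl, if_neg (by omega), if_neg (by omega)]
    exact ⟨zero_lt_one, le_rfl⟩
  refine Finset.mem_filter.2 ⟨mem_irreducibleBridges.2 ⟨mem_bridges.2 ⟨liftWalk_mem_saws d hσ, hb⟩,
    ⟨by omega, hb, fun k hk1 hk2 hren => ?_⟩⟩, ?_⟩
  · have h := (hren.2.2 1 le_rfl (by omega)).1
    simp only [add_zero, liftWalk_apply_zero] at h
    rw [if_neg (by omega), if_neg (by omega)] at h
    exact lt_irrefl _ h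
  · simp [costZd, liftWalk_apply_zero]

/-! ### Conversely: a cost-`c` irreducible bridge of length `c + 1` is the lift of its transverse part -/

/-- The transverse part of a cost-`c` irreducible bridge of length `c+1` is a `c`-step self-avoiding walk of `ℤ^d`, and the bridge is its lift.
[cite: MadrasSlade1993, Definition 1.2.4] -/
theorem dropWalk_mem_saws_and_eq (d : ℕ) {c : ℕ} {ω : ℕ → Site (d + 1)}
    (hω : ω ∈ (irreducibleBridges (d + 1) (c + 1)).filter fun ω => costZd d (c + 1) ω = c) :
    dropWalk d ω ∈ saws d c ∧ ω = liftWalk d (dropWalk d ω) := by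
  obtain ⟨hirr, hcost⟩ := Finset.mem_filter.1 hω
  obtain ⟨hbr, -⟩ := mem_irreducibleBridges.1 hirr
  obtain ⟨hωs, hb⟩ := mem_bridges.1 hbr
  obtain ⟨h0, hend, hadj, hinj⟩ := mem_saws.1 hωs
  have hω1 : ω 1 = Pi.single 0 1 := apply_one_eq_e0_of_mem_bridges d (by omega) hbr
  have hlast : ω (c + 1) 0 = 1 := by
    have hc : costZd d (c + 1) ω = c := hcost
    simp only [costZd] at hc
    have := (span_le_and_cost_bound_zd hirr).1
    have hpos : 0 < ω (c + 1) 0 := by have := (hb (c + 1) (by omega) le_rfl).1; rwa [h0] at this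
    omega
  have hone : ∀ i, 1 ≤ i → i ≤ c + 1 → ω i 0 = 1 := by
    intro i hi1 hi2
    have h := hb i hi1 hi2
    rw [h0, hlast] at h
    simp only [Pi.zero_apply] at h
    omega
  have hone' : ∀ i, 1 ≤ i → ω i 0 = 1 := by
    intro i hi1
    rcases Nat.lt_or_ge (c + 1) i with h | h
    · rw [hend i h.le]; exact hlast
    · exact hone i hi1 h
  have heq : ω = liftWalk d (dropWalk d ω) := by
    funext i
    rcases i with _ | i
    · rw [liftWalk_zero, h0]
    · rw [liftWalk_succ, dropWalk]
      exact eq_cons_tail_of_apply_zero (hone' (i + 1) (by omega))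
  refine ⟨mem_saws.2 ⟨?_, fun i hi => ?_, fun i hi => ?_, ?_⟩, heq⟩
  · rw [dropWalk, zero_add, hω1]
    ext j
    simp [Fin.tail]
  · simp only [dropWalk]
    rw [hend (i + 1) (by omega)]
  · have ha := hadj (i + 1) (by omega)
    rw [eq_cons_tail_of_apply_zero (hone (i + 1) (by omega) (by omega)),
      eq_cons_tail_of_apply_zero (hone (i + 1 + 1) (by omega) (by omega)), adj_cons_iff] at ha
    exact ha
  · intro i hi j hj h
    simp only [Set.mem_setOf_eq] at hi hj
    have h' : ω (i + 1) = ω (j + 1) := by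
      rw [eq_cons_tail_of_apply_zero (hone (i + 1) (by omega) (by omega)),
        eq_cons_tail_of_apply_zero (hone (j + 1) (by omega) (by omega))]
      exact congrArg (fun τ : Site d => (Fin.cons (1 : ℤ) τ : Site (d + 1))) h
    have := hinj (show i + 1 ∈ {k | k ≤ c + 1} by simp only [Set.mem_setOf_eq]; omega)
      (show j + 1 ∈ {k | k ≤ c + 1} by simp only [Set.mem_setOf_eq]; omega) h'
    omega

/-- `liftWalk` is injective. [cite: MadrasSlade1993, Definition 1.2.4] -/
theorem liftWalk_injective (d : ℕ) : Function.Injective (liftWalk d) := by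
  intro σ σ' h
  funext i
  have := congrFun h (i + 1)
  rw [liftWalk_succ, liftWalk_succ] at this
  simpa using congrArg Fin.tail this

/-- ★ The cost-`c` irreducible bridges of `ℤ^{d+1}` of length `c + 1` are exactly the lifts of the `c`-step self-avoiding walks of `ℤ^d`.
[cite: MadrasSlade1993, §4.2, eq. (4.2.20)–(4.2.22) (p. 94, 2013 reprint)] -/
theorem filter_costZd_self_succ_eq_image (d c : ℕ) [DecidableEq (ℕ → Site (d + 1))] :
    ((irreducibleBridges (d + 1) (c + 1)).filter fun ω => costZd d (c + 1) ω = c) = (saws d c).image (liftWalk d) := by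
  ext ω
  constructor
  · intro h
    obtain ⟨hs, heq⟩ := dropWalk_mem_saws_and_eq d h
    exact Finset.mem_image.2 ⟨dropWalk d ω, hs, heq.symm⟩
  · intro h
    obtain ⟨σ, hσ, rfl⟩ := Finset.mem_image.1 h
    exact liftWalk_mem_filter d hσ

/-- ★★ **`N_{c,c+1}(ℤ^{d+1}) = c_c(ℤ^d)`**: the number of irreducible bridges of `ℤ^{d+1}` of length `c + 1` and cost `c` (i.e. span one) is
the number of `c`-step self-avoiding walks of `ℤ^d`. [cite: MadrasSlade1993, §4.2, eq. (4.2.20)–(4.2.22) (p. 94, 2013 reprint)] -/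
theorem costCoeffZd_self_succ (d c : ℕ) : costCoeffZd d c (c + 1) = count d c := by
  classical
  rw [costCoeffZd, filter_costZd_self_succ_eq_image, Finset.card_image_of_injective _ (liftWalk_injective d), card_saws]

/-- Corollary: `c₁(ℤ^d) = 2d` in every dimension (from `N_{1,2} = 2d`). [cite: MadrasSlade1993, §1.2] -/
theorem count_one_eq_two_mul (d : ℕ) : count d 1 = 2 * d := by
  rw [← costCoeffZd_self_succ, costCoeffZd_one_two]

/-- Corollary: `c₂(ℤ^d) = 2d(2d−1)` in every dimension (from `N_{2,3} = 2d(2d−1)`). [cite: MadrasSlade1993, §1.2] -/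
theorem count_two_eq (d : ℕ) : count d 2 = 2 * d * (2 * d - 1) := by
  rw [← costCoeffZd_self_succ, costCoeffZd_two_three]

end Literature.Probability.RandomPlanarGeometry.SAW.Zd

end
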